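import Mathlib
import Summits.ValiantsHypothesis.ValiantsHypothesis.Theorems.RigidityForcesSymmetryRankRigidMinimalReprLaplaceFiveSeparatedCaptureLinesParallel
import Summits.ValiantsHypothesis.ValiantsHypothesis.Theorems.RigidityForcesSymmetryRankRigidMinimalReprLaplaceFiveSeparatedCaptureEqualLinesK1
import Summits.ValiantsHypothesis.ValiantsHypothesis.Theorems.RigidityForcesSymmetryRankRigidMinimalReprLaplaceFiveSeparatedCaptureLeadingMonomials

/-!
# ValiantsHypothesis / RigidityForcesSymmetry — crux `LaplaceOptimalFive` (stmt-ValiantsHypothesis-24813), symmetric capture: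
# ★★ **THE PROFILE `(1,1,1)` OF `CaptureIneqSym` IS A THEOREM** (three triangle LINES ⇒ `finrank W ≤ 3`)

Assembly, in `CaptureIneqSym`'s own currency, of ✓ `captureIneqSym_equalLines` (val-lit-p4 g17: the three lines coincide) and
✓ `finrank_le_two_of_lines` (this seat: two of the lines differ ⇒ `finrank W ≤ 2`).  For NON-ZERO symmetric `u₁, u₂, u₃` and
`U₀₁ = ℂ·u₁, U₀₂ = ℂ·u₂, U₁₂ = ℂ·u₃`, every captured space `W` of symmetric zero-diagonal leaf matrices has
`finrank W ≤ finrank U₀₁ + finrank U₀₂ + finrank U₁₂ (= 3)`.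

* `lines_form_of_mem_L3` — reading a member of `L₃(ℂu₁, ℂu₂, ℂu₃)` as `u₁(p,q)a_r + u₂(p,r)b_q + u₃(q,r)c_p` (✓ `L3_finite_form`).
* ★★ `captureIneqSym_of_lines` — the profile `(1,1,1)`.

Honest framing.  A SUB-CASE (profile `(1,1,1)`: one short-factor direction per triangle cut) of the OPEN inequality `CaptureIneqSym`;
profiles with a 2-dimensional span, K1 on `K₃ ⊔ K₂` in general, S2′, `LaplaceOptimalFive` (OPEN · CONTESTED 72/120),
`RankRigidMinimalRepr`, `VP ≠ VNP` are NOT proved.  No definitions, no `sorry`.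
-/

set_option linter.dupNamespace false
set_option autoImplicit false

namespace Summit.ValiantsHypothesis.ValiantsHypothesis.Theorems.RigidityForcesSymmetryRankRigidMinimalRepr

namespace LaplaceFiveSeparatedCapture

open Finset LaplaceFiveSectorSplit

/-- Reading: a member of `L₃(ℂu₁, ℂu₂, ℂu₃)` is `u₁(p,q)a_r + u₂(p,r)b_q + u₃(q,r)c_p`. [folklore] -/
theorem lines_form_of_mem_L3 (u₁ u₂ u₃ : Fin 5 → Fin 5 → ℂ) {T : Fin 5 → Fin 5 → Fin 5 → ℂ}
    (hT : T ∈ L3 (ℂ ∙ u₁) (ℂ ∙ u₂) (ℂ ∙ u₃)) :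
    ∃ a b c : Fin 5 → ℂ, ∀ p q r, T p q r = u₁ p q * a r + u₂ p r * b q + u₃ q r * c p := by
  obtain ⟨A, B, C, hA, hB, hC, hT⟩ := L3_finite_form _ _ _ hT
  have hA' : ∀ r, ∃ κ : ℂ, κ • u₁ = A r := fun r => Submodule.mem_span_singleton.mp (hA r)
  have hB' : ∀ r, ∃ κ : ℂ, κ • u₂ = B r := fun r => Submodule.mem_span_singleton.mp (hB r)
  have hC' : ∀ r, ∃ κ : ℂ, κ • u₃ = C r := fun r => Submodule.mem_span_singleton.mp (hC r)
  choose a ha using hA'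
  choose b hb using hB'
  choose c hc using hC'
  refine ⟨a, b, c, fun p q r => ?_⟩
  rw [hT p q r, ← ha r, ← hb q, ← hc p]
  simp only [Pi.smul_apply, smul_eq_mul]
  ring

/-- ★★ **THE PROFILE `(1,1,1)` OF THE SYMMETRIC CAPTURE INEQUALITY.**  Three NON-ZERO symmetric letter matrices `u₁, u₂, u₃`,
`U₀₁ = ℂ·u₁`, `U₀₂ = ℂ·u₂`, `U₁₂ = ℂ·u₃`, `W` captured ⇒ `finrank W ≤ finrank U₀₁ + finrank U₀₂ + finrank U₁₂`.
All three lines equal: ✓ `captureIneqSym_equalLines`; `u₁ ∉ ℂ·u₂`: ✓ `finrank_le_two_of_lines`; `u₁ ∈ ℂ·u₂` but `u₃ ∉ ℂ·u₂`: the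
same theorem for the relabelled reading `u₃(p,q)c_r + u₂(p,r)b_q + u₁(q,r)a_p` of `T(r,q,p)`. [folklore] -/
theorem captureIneqSym_of_lines (u₁ u₂ u₃ : Fin 5 → Fin 5 → ℂ)
    (hu₁ : ∀ p q, u₁ p q = u₁ q p) (hu₂ : ∀ p q, u₂ p q = u₂ q p) (hu₃ : ∀ p q, u₃ p q = u₃ q p)
    (hn₁ : u₁ ≠ 0) (hn₂ : u₂ ≠ 0) (hn₃ : u₃ ≠ 0)
    (U01 U02 U12 W : Submodule ℂ (Fin 5 → Fin 5 → ℂ))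
    (h01 : U01 = ℂ ∙ u₁) (h02 : U02 = ℂ ∙ u₂) (h12 : U12 = ℂ ∙ u₃)
    (hWs : ∀ μ ∈ W, ∀ s t : Fin 5, μ s t = μ t s) (hWd : ∀ μ ∈ W, ∀ s : Fin 5, μ s s = 0)
    (hWc : ∀ μ ∈ W, contractZ μ ∈ L3 U01 U02 U12) :
    Module.finrank ℂ W ≤ Module.finrank ℂ U01 + Module.finrank ℂ U02 + Module.finrank ℂ U12 := by
  classical
  have hform : ∀ μ ∈ W, ∃ a b c : Fin 5 → ℂ, ∀ p q r,
      contractZ μ p q r = u₁ p q * a r + u₂ p r * b q + u₃ q r * c p := by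
    intro μ hμ
    have h := hWc μ hμ
    rw [h01, h02, h12] at h
    exact lines_form_of_mem_L3 u₁ u₂ u₃ h
  have hd1 : Module.finrank ℂ U01 = 1 := by rw [h01]; exact finrank_span_singleton hn₁
  have hd2 : Module.finrank ℂ U02 = 1 := by rw [h02]; exact finrank_span_singleton hn₂
  have hd3 : Module.finrank ℂ U12 = 1 := by rw [h12]; exact finrank_span_singleton hn₃
  by_cases hp12 : ∃ κ : ℂ, u₁ = κ • u₂
  · by_cases hp32 : ∃ κ : ℂ, u₃ = κ • u₂
    · -- all three lines coincide with `ℂ·u₂`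
      obtain ⟨κ₁, hκ₁⟩ := hp12
      obtain ⟨κ₃, hκ₃⟩ := hp32
      have hκ₁0 : κ₁ ≠ 0 := by rintro rfl; exact hn₁ (by rw [hκ₁, zero_smul])
      have hκ₃0 : κ₃ ≠ 0 := by rintro rfl; exact hn₃ (by rw [hκ₃, zero_smul])
      have e1 : (ℂ ∙ u₁ : Submodule ℂ (Fin 5 → Fin 5 → ℂ)) = ℂ ∙ u₂ := by
        rw [hκ₁]; exact Submodule.span_singleton_smul_eq (IsUnit.mk0 κ₁ hκ₁0) u₂
      have e3 : (ℂ ∙ u₃ : Submodule ℂ (Fin 5 → Fin 5 → ℂ)) = ℂ ∙ u₂ := by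
        rw [hκ₃]; exact Submodule.span_singleton_smul_eq (IsUnit.mk0 κ₃ hκ₃0) u₂
      exact captureIneqSym_equalLines u₂ hu₂ hn₂ U01 U02 U12 W (h01.trans e1) h02 (h12.trans e3) hWs hWd hWc
    · -- `u₃ ∉ ℂ·u₂`: relabelled reading `T(r,q,p)`
      have hform' : ∀ μ ∈ W, ∃ a b c : Fin 5 → ℂ, ∀ p q r,
          contractZ μ p q r = u₃ p q * a r + u₂ p r * b q + u₁ q r * c p := by
        intro μ hμ
        obtain ⟨a, b, c, h⟩ := hform μ hμ
        refine ⟨c, b, a, fun p q r => ?_⟩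
        rw [contractZ_swap12 μ q p r, contractZ_swap23 μ q r p, contractZ_swap12 μ r q p, h r q p,
          hu₁ r q, hu₂ r p, hu₃ q p]
        ring
      have h := finrank_le_two_of_lines u₃ u₂ u₁ hu₃ hu₂ hu₁ hp32 W hWs hWd hform'
      omega
  · have h := finrank_le_two_of_lines u₁ u₂ u₃ hu₁ hu₂ hu₃ hp12 W hWs hWd hform
    omega

end LaplaceFiveSeparatedCapture

end Summit.ValiantsHypothesis.ValiantsHypothesis.Theorems.RigidityForcesSymmetryRankRigidMinimalRepr
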